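import Literature.AlgebraicGeometry.Frobenioids.DivisorMonoidRightEqLeftLocal
import Literature.AlgebraicGeometry.Frobenioids.DivisorMonoidIsoDivFrobTrivial
import Literature.AlgebraicGeometry.Frobenioids.Thm49StrictlyRationalWLOG
import Literature.AlgebraicGeometry.Frobenioids.TwinPrimaryCriterionProofs
import HarnessLib

/-!
# [FrdI] Thm. 4.9, p. 89 l. 38 – p. 90 l. 4: "the right-hand and left-hand isomorphisms coincide
# for all universally Div-Frobenius-trivial objects" — assembly from rows T49-L05/L06/L07

Mochizuki, *The geometry of Frobenioids I: the general theory*, Kyushu J. Math. **62** (2008)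
293–400, §4, proof of Theorem 4.9 (Kyushu text p. 370 l. 59 – p. 371 l. 9)
[cite: MochizukiFrdI2008, Thm. 4.9 p.89]:

> "To prove that the right-hand and left-hand isomorphisms of Theorem 4.2 (iii) coincide for all
> universally Div-Frobenius-trivial objects, we reason as follows. … we may assume without loss of
> generality that `C₁`, `C₂` are of perfect type … Let `A` be a universally Div-Frobenius-trivial
> object … Since the right-hand and left-hand isomorphisms … are clearly compatible with pull-back
> morphisms … and `Ψ` preserves pull-back morphisms …, we may assume without loss of generality that
> `A` is strictly rational. … Then, it suffices to show, for each `𝔭 ∈ Prime(Φ₁(A))`, the existence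
> of twin-primary steps with zero divisor in `𝔭` that are mapped by `Ψ` to twin-primary steps of `C₂`."

PROOF-ONLY assembly (seat abc-iut-w4-d099; no definitions, nothing asserted as a `Prop`). In a
`FrdI.T42.Setting` (perfect and isotropic type, "after passing to perfections") with `Ψ` preserving and
reflecting primary pre-steps [Thm. 4.2 (i)], a prime correspondence `e` with the clauses (a), (b) of
Thm. 4.2 (ii) [`Ψ^Prime`, `PreFrobenioid.existsUnique_primesEquiv_family`], `Ψ` preserving the
Div-identity endomorphisms of Div-Frobenius-trivial objects [Thm. 4.2 (i), row T42-L11], and a class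
`P` of objects ("strictly rational") such that (α) every `P`-object carries, for every prime, twin-primary
steps mapped by `Ψ` to twin-primary steps [rows T49-L07/L08′,
`FrdI.T49.exists_twinPrimary_pair_of_isStrictlyRational`] and (β) every universally
Div-Frobenius-trivial object receives a pull-back morphism from a `P`-object ["`A` rational",
Def. 4.5 (ii)(iii)] — the slots `RightEqLeftAt F₁ F₂ Ψ A 𝔭 (e A 𝔭)` hold at every universally
Div-Frobenius-trivial `A` and every prime `𝔭` (`rightEqLeftAt_of_cover`), i.e. the last hypothesis of
`FrdI.T49.SufficesRightEqLeft` (row T49-L02). Route: at the `P`-cover `A′ → A` (Div-Frobenius-trivial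
by the definition of "universally"), row T49-L06 (`FrdI.T49.twinPrimaryCriterion_holds`, seat
abc-iut-w4-d105) gives the prime-local slots at `A′`; they glue to ONE isomorphism of monoids with the
right- and left-hand properties (`FrdI.T49.exists_mulEquiv_of_rightEqLeftAt`,
`DivisorMonoidRightEqLeft.lean`); row T49-L05 (`FrdI.T49.leftHand_of_leftHand_of_isPullbackMorphism`,
seat abc-iut-w4-d109) transports the left-hand property down the pull-back morphism to the monoid
isomorphism of `DivisorMonoidIsoDivFrobTrivial.lean` at `A`; `rightEqLeftAt_of_mulEquiv`
(`DivisorMonoidRightEqLeftLocal.lean`) restricts back to the prime rays. Nothing here bears on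
[IUTchIII].
-/

namespace Literature.AlgebraicGeometry.Frobenioids

open CategoryTheory Opposite

namespace FrdI.T49

universe w v v' u u'

variable {D₁ : Type u} [Category.{v} D₁] {Φ₁ : D₁ᵒᵖ ⥤ CommMonCat.{w}} {C₁ : Type u'} [Category.{v'} C₁]
  {D₂ : Type u} [Category.{v} D₂] {Φ₂ : D₂ᵒᵖ ⥤ CommMonCat.{w}} {C₂ : Type u'} [Category.{v'} C₂]
  {F₁ : C₁ ⥤ ElemFrobenioid Φ₁} {F₂ : C₂ ⥤ ElemFrobenioid Φ₂} {Ψ : C₁ ≌ C₂}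

/-- **Global right = left at a Div-Frobenius-trivial object with twin-primary witnesses** (p. 90
ll. 1–4 with Thm. 4.2 (iii)): in a `T42.Setting`, at a Div-Frobenius-trivial `A` whose Div-identity
endomorphisms `Ψ` preserves, if a prime correspondence `e𝔭` satisfies the clauses (a), (b) of
Thm. 4.2 (ii) and every prime carries twin-primary steps mapped to twin-primary steps, then ONE
isomorphism of monoids `M : Φ₁(A) ≃* Φ₂(Ψ A)` has the right-hand property on all pre-steps out of `A`
and the left-hand property on all pre-steps into `A`. [cite: MochizukiFrdI2008, Thm. 4.9 p.90] -/
theorem exists_mulEquiv_right_left_of_twinPrimary (S : T42.Setting F₁ F₂ Ψ) {A : C₁}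
    (hA : PreFrobenioid.IsDivFrobeniusTrivial F₁ A)
    (hdivid : ∀ α : A ⟶ A, PreFrobenioid.IsDivIdentity F₁ α →
      PreFrobenioid.IsDivIdentity F₂ (Ψ.functor.map α))
    (e𝔭 : Primes (Φ₁.obj (op (PreFrobenioid.baseObj F₁ A))) →
      Primes (Φ₂.obj (op (PreFrobenioid.baseObj F₂ (Ψ.functor.obj A)))))
    (ha : ∀ (𝔭 : Primes (Φ₁.obj (op (PreFrobenioid.baseObj F₁ A)))) ⦃B : C₁⦄ (φ : A ⟶ B),
      PreFrobenioid.IsCoAngularPreStep F₁ φ →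
        (PreFrobenioid.Div F₁ φ ∈ 𝔭.submonoid ↔
          PreFrobenioid.Div F₂ (Ψ.functor.map φ) ∈ (e𝔭 𝔭).submonoid))
    (hb : ∀ (𝔭 : Primes (Φ₁.obj (op (PreFrobenioid.baseObj F₁ A)))) ⦃B : C₁⦄ (ψ : B ⟶ A),
      PreFrobenioid.IsCoAngularPreStep F₁ ψ →
        ((∃ y ∈ 𝔭.submonoid, pull Φ₁ (PreFrobenioid.Base F₁ ψ) y = PreFrobenioid.Div F₁ ψ) ↔
          ∃ y ∈ (e𝔭 𝔭).submonoid, pull Φ₂ (PreFrobenioid.Base F₂ (Ψ.functor.map ψ)) y =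
            PreFrobenioid.Div F₂ (Ψ.functor.map ψ)))
    (htwin : ∀ 𝔭 : Primes (Φ₁.obj (op (PreFrobenioid.baseObj F₁ A))),
      ∃ (B C' : C₁) (β : A ⟶ B) (γ : C' ⟶ A), IsTwinPrimary F₁ β γ ∧
        PreFrobenioid.Div F₁ β ∈ 𝔭.carrier ∧ IsTwinPrimary F₂ (Ψ.functor.map β) (Ψ.functor.map γ)) :
    ∃ M : Φ₁.obj (op (PreFrobenioid.baseObj F₁ A)) ≃*
        Φ₂.obj (op (PreFrobenioid.baseObj F₂ (Ψ.functor.obj A))),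
      (∀ ⦃B : C₁⦄ (φ : A ⟶ B), PreFrobenioid.IsPreStep F₁ φ →
          M (PreFrobenioid.Div F₁ φ) = PreFrobenioid.Div F₂ (Ψ.functor.map φ)) ∧
      ∀ ⦃B : C₁⦄ (ψ : B ⟶ A), PreFrobenioid.IsPreStep F₁ ψ →
        ∀ y : Φ₁.obj (op (PreFrobenioid.baseObj F₁ A)),
          pull Φ₁ (PreFrobenioid.Base F₁ ψ) y = PreFrobenioid.Div F₁ ψ →
            pull Φ₂ (PreFrobenioid.Base F₂ (Ψ.functor.map ψ)) (M y) =
              PreFrobenioid.Div F₂ (Ψ.functor.map ψ) :=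
  exists_mulEquiv_of_rightEqLeftAt S fun 𝔭 =>
    ⟨e𝔭 𝔭, twinPrimaryCriterion_holds F₁ F₂ Ψ S hA hdivid 𝔭 (e𝔭 𝔭) (ha 𝔭) (hb 𝔭) (htwin 𝔭)⟩

/-- **"Right = left" at every universally Div-Frobenius-trivial object, from a cover by `P`-objects**
(p. 89 l. 38 – p. 90 l. 4, assembled): in a `T42.Setting` with `Ψ` preserving and reflecting primary
pre-steps, given a prime correspondence `e` with the clauses (a), (b) of Thm. 4.2 (ii) at every object,
`Ψ` preserving the Div-identity endomorphisms of Div-Frobenius-trivial objects, and a class of objects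
`P` such that every `P`-object carries twin-primary witnesses at every prime [rows T49-L07/L08′ for
`P` = strictly rational] and every universally Div-Frobenius-trivial object receives a pull-back
morphism from a `P`-object ["rational"], the slot `RightEqLeftAt F₁ F₂ Ψ A 𝔭 (e A 𝔭)` holds at every
universally Div-Frobenius-trivial `A` and every prime `𝔭` — the last hypothesis of
`FrdI.T49.SufficesRightEqLeft`. [cite: MochizukiFrdI2008, Thm. 4.9 p.89] -/
theorem rightEqLeftAt_of_cover (S : T42.Setting F₁ F₂ Ψ)
    (hprim : ∀ ⦃X Y : C₁⦄ (φ : X ⟶ Y), PreFrobenioid.IsPrimaryPreStep F₁ φ →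
      PreFrobenioid.IsPrimaryPreStep F₂ (Ψ.functor.map φ))
    (hprim' : ∀ ⦃X Y : C₂⦄ (φ : X ⟶ Y), PreFrobenioid.IsPrimaryPreStep F₂ φ →
      PreFrobenioid.IsPrimaryPreStep F₁ (Ψ.inverse.map φ))
    (e : ∀ A : C₁, Primes (Φ₁.obj (op (PreFrobenioid.baseObj F₁ A))) →
      Primes (Φ₂.obj (op (PreFrobenioid.baseObj F₂ (Ψ.functor.obj A)))))
    (ha : ∀ (A : C₁) (𝔭 : Primes (Φ₁.obj (op (PreFrobenioid.baseObj F₁ A)))) ⦃B : C₁⦄ (φ : A ⟶ B),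
      PreFrobenioid.IsCoAngularPreStep F₁ φ →
        (PreFrobenioid.Div F₁ φ ∈ 𝔭.submonoid ↔
          PreFrobenioid.Div F₂ (Ψ.functor.map φ) ∈ (e A 𝔭).submonoid))
    (hb : ∀ (A : C₁) (𝔭 : Primes (Φ₁.obj (op (PreFrobenioid.baseObj F₁ A)))) ⦃B : C₁⦄ (ψ : B ⟶ A),
      PreFrobenioid.IsCoAngularPreStep F₁ ψ →
        ((∃ y ∈ 𝔭.submonoid, pull Φ₁ (PreFrobenioid.Base F₁ ψ) y = PreFrobenioid.Div F₁ ψ) ↔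
          ∃ y ∈ (e A 𝔭).submonoid, pull Φ₂ (PreFrobenioid.Base F₂ (Ψ.functor.map ψ)) y =
            PreFrobenioid.Div F₂ (Ψ.functor.map ψ)))
    (hdivid : ∀ ⦃A : C₁⦄, PreFrobenioid.IsDivFrobeniusTrivial F₁ A → ∀ α : A ⟶ A,
      PreFrobenioid.IsDivIdentity F₁ α → PreFrobenioid.IsDivIdentity F₂ (Ψ.functor.map α))
    (P : C₁ → Prop)
    (htwin : ∀ ⦃A' : C₁⦄, P A' → ∀ 𝔮 : Primes (Φ₁.obj (op (PreFrobenioid.baseObj F₁ A'))),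
      ∃ (B C' : C₁) (β : A' ⟶ B) (γ : C' ⟶ A'), IsTwinPrimary F₁ β γ ∧
        PreFrobenioid.Div F₁ β ∈ 𝔮.carrier ∧ IsTwinPrimary F₂ (Ψ.functor.map β) (Ψ.functor.map γ))
    (hcover : ∀ ⦃A : C₁⦄, PreFrobenioid.IsUniversallyDivFrobeniusTrivial F₁ A →
      ∃ (A' : C₁) (ψ : A' ⟶ A), PreFrobenioid.IsPullbackMorphism F₁ ψ ∧ P A')
    (A : C₁) (hA : PreFrobenioid.IsUniversallyDivFrobeniusTrivial F₁ A)
    (𝔭 : Primes (Φ₁.obj (op (PreFrobenioid.baseObj F₁ A)))) : RightEqLeftAt F₁ F₂ Ψ A 𝔭 (e A 𝔭) := by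
  have hco : ∀ {X Y : C₁} (f : X ⟶ Y), PreFrobenioid.IsCoAngular F₁ f :=
    fun f => PreFrobenioid.isCoAngular_of_isIsotropic_codomains F₁ f fun Z _ => S.isotropic₁ Z
  -- the `P`-cover `ψ : A' → A`; `A'` is Div-Frobenius-trivial
  obtain ⟨A', ψ, hψ, hPA'⟩ := hcover hA
  have hA' : PreFrobenioid.IsDivFrobeniusTrivial F₁ A' := hA ψ hψ
  -- global right = left at `A'` (rows T49-L06/L07, glued)
  obtain ⟨M', hM'r, hM'l⟩ := exists_mulEquiv_right_left_of_twinPrimary S hA' (hdivid hA') (e A')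
    (ha A') (hb A') (htwin hPA')
  -- the right-hand monoid isomorphism at `A`
  obtain ⟨M, hMr⟩ := S.exists_mulEquiv_div_map_of_isDivFrobeniusTrivial hprim hprim'
    hA.isDivFrobeniusTrivial (hdivid hA.isDivFrobeniusTrivial)
  -- transport of the left-hand property down `ψ` (row T49-L05)
  have hMl := leftHand_of_leftHand_of_isPullbackMorphism F₁ F₂ Ψ S ψ hψ M' M hM'r hMr
    (fun B' χ hχ y hy => hM'l χ hχ.2 y hy)
  -- back to the prime ray `𝔭`
  exact rightEqLeftAt_of_mulEquiv S.isFrobenioid₁ M hMr (fun B χ hχ y hy => hMl χ ⟨hco χ, hχ⟩ y hy)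
    𝔭 (e A 𝔭) (ha A 𝔭)

/-- The same with the prime correspondence `Ψ^Prime` of Thm. 4.2 (ii) supplied by
`PreFrobenioid.existsUnique_primesEquiv_family` (row T42-L08): the last TWO data of
`FrdI.T49.SufficesRightEqLeft` — a family `e` and the slots `RightEqLeftAt` at all universally
Div-Frobenius-trivial objects — exist together. [cite: MochizukiFrdI2008, Thm. 4.9 p.89] -/
theorem exists_primesEquiv_rightEqLeftAt_of_cover (S : T42.Setting F₁ F₂ Ψ)
    (hprim : ∀ ⦃X Y : C₁⦄ (φ : X ⟶ Y), PreFrobenioid.IsPrimaryPreStep F₁ φ →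
      PreFrobenioid.IsPrimaryPreStep F₂ (Ψ.functor.map φ))
    (hprim' : ∀ ⦃X Y : C₂⦄ (φ : X ⟶ Y), PreFrobenioid.IsPrimaryPreStep F₂ φ →
      PreFrobenioid.IsPrimaryPreStep F₁ (Ψ.inverse.map φ))
    (hdivid : ∀ ⦃A : C₁⦄, PreFrobenioid.IsDivFrobeniusTrivial F₁ A → ∀ α : A ⟶ A,
      PreFrobenioid.IsDivIdentity F₁ α → PreFrobenioid.IsDivIdentity F₂ (Ψ.functor.map α))
    (P : C₁ → Prop)
    (htwin : ∀ ⦃A' : C₁⦄, P A' → ∀ 𝔮 : Primes (Φ₁.obj (op (PreFrobenioid.baseObj F₁ A'))),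
      ∃ (B C' : C₁) (β : A' ⟶ B) (γ : C' ⟶ A'), IsTwinPrimary F₁ β γ ∧
        PreFrobenioid.Div F₁ β ∈ 𝔮.carrier ∧ IsTwinPrimary F₂ (Ψ.functor.map β) (Ψ.functor.map γ))
    (hcover : ∀ ⦃A : C₁⦄, PreFrobenioid.IsUniversallyDivFrobeniusTrivial F₁ A →
      ∃ (A' : C₁) (ψ : A' ⟶ A), PreFrobenioid.IsPullbackMorphism F₁ ψ ∧ P A') :
    ∃ e : ∀ A : C₁, Primes (Φ₁.obj (op (PreFrobenioid.baseObj F₁ A))) ≃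
        Primes (Φ₂.obj (op (PreFrobenioid.baseObj F₂ (Ψ.functor.obj A)))),
      (∀ (A : C₁) (𝔭 : Primes (Φ₁.obj (op (PreFrobenioid.baseObj F₁ A)))),
        (∀ ⦃B : C₁⦄ (φ : A ⟶ B), PreFrobenioid.IsCoAngularPreStep F₁ φ →
            (PreFrobenioid.Div F₁ φ ∈ 𝔭.submonoid ↔
              PreFrobenioid.Div F₂ (Ψ.functor.map φ) ∈ (e A 𝔭).submonoid)) ∧
        ∀ ⦃B : C₁⦄ (ψ : B ⟶ A), PreFrobenioid.IsCoAngularPreStep F₁ ψ →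
          ((∃ y ∈ 𝔭.submonoid, pull Φ₁ (PreFrobenioid.Base F₁ ψ) y = PreFrobenioid.Div F₁ ψ) ↔
            ∃ y ∈ (e A 𝔭).submonoid, pull Φ₂ (PreFrobenioid.Base F₂ (Ψ.functor.map ψ)) y =
              PreFrobenioid.Div F₂ (Ψ.functor.map ψ))) ∧
      ∀ (A : C₁), PreFrobenioid.IsUniversallyDivFrobeniusTrivial F₁ A →
        ∀ 𝔭 : Primes (Φ₁.obj (op (PreFrobenioid.baseObj F₁ A))), RightEqLeftAt F₁ F₂ Ψ A 𝔭 (e A 𝔭) := by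
  obtain ⟨e, he⟩ := (PreFrobenioid.existsUnique_primesEquiv_family Ψ S.isFrobenioid₁ S.isFrobenioid₂
    S.perfect₁ S.perfect₂ S.isotropic₁ S.isotropic₂ S.perfFactorial₁ S.perfFactorial₂ S.step_map
    S.step_inv S.preStep_map S.preStep_inv hprim hprim').exists
  exact ⟨e, he, fun A hA 𝔭 => rightEqLeftAt_of_cover S hprim hprim' (fun A => e A)
    (fun A 𝔭 => (he A 𝔭).1) (fun A 𝔭 => (he A 𝔭).2) hdivid P htwin hcover A hA 𝔭⟩

end FrdI.T49

end Literature.AlgebraicGeometry.Frobenioids
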